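import Summits.BirchSwinnertonDyer.Rank1Residual.GaloisImage.LocalThreeTorsionDeciderAt
import Mathlib.NumberTheory.Padics.HeightOneSpectrum
import HarnessLib

/-!
# The two numerals of the "same twist type" clause at a multiplicative place `w`, DECIDED:
# `-c₄/c₆ ∼ -c₄′/c₆′` in `ℚ_wˣ/ℚ_wˣ²` and `μ₃(ℚ_w) = 1` (team n1011, row T-LOC3L, FILE L6)

HONEST FRAMING (cell `b2b-bsdres`, run/shared/lean/b2b/bsd-rank1-residual/, verbatim in every
file): the goal of the cell is to DELETE the COMBINATION-SHAPED residual classes of the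
Birch–Swinnerton-Dyer formula for ALL analytic-rank `≤ 1` elliptic curves over `ℚ` — "full BSD
formula for every rank `≤ 1` curve in class `C`" assembled STRICTLY from published theorems — so
that the rank-`≤ 1` remainder becomes exactly the CONSTRUCTION-SHAPED classes, which are TYPED
(missing-input `Prop`s), NOT attempted. This is not "finishing BSD". Team n1011 (N10/N11 = X4 ∧
`p = 3`, research route; ROW T-VIS3 = the visible / congruence LOWER bound at additive `3`). THIS
FILE IS A TOOL: theorems only (no definition, no named fact, no `sorry`); it closes nothing, books
nothing, moves no mark / label / count.

## What

Free kind (iii) of p04's `Visible.sq_dvd_card_sha_three_of_congr_of_places`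
(`GaloisImage/VisibleLowerBoundThree.lean`) asks, at a place `w` where both curves are
multiplicative, for
`(∃ r : ℚ_w, ι(-(c₄/c₆)) = r² · ι(-(c₄′/c₆′))) ∧ (∀ ζ : ℚ_w, ζ³ = 1 → ζ = 1)`
(`ι = algebraMap ℚ (w.adicCompletion ℚ)`; Silverman ATAEC V.5.3: `γ = -c₄/c₆ ∈ ℚ_wˣ/ℚ_wˣ²` is the
twist type of a multiplicative curve). Both conjuncts are SQUARE-CLASS statements about RATIONAL
numbers in `ℚ_w`, hence `decide`-able through FILE L1's `isSquare_intCast_padic_iff` and FILE L3's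
computable flag `sqFlagAt`:

* `isSquare_algebraMap_adicCompletion_iff_padic` — `IsSquare (ι q) ↔ IsSquare ((q : ℚ) : ℚ_[p])`
  at the place `w` of `p` (transport along Mathlib's `adicCompletion.padicEquiv`);
* `isSquare_ratCast_padic_iff_intCast` — for integers `N`, `D ≠ 0`:
  `IsSquare ((N / D : ℚ) : ℚ_[p]) ↔ IsSquare ((N * D : ℤ) : ℚ_[p])`;
* **`exists_eq_sq_mul_of_sqFlagAt`** — the first conjunct from `A / B = N / D` (rational literals
  the record computes by `norm_num` from the two models), `p^w ∥ N·D` and `sqFlagAt p (N * D) w = true`;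
* `not_isSquare_algebraMap_adicCompletion_of_sqFlagAt` / `isSquare_algebraMap_adicCompletion_of_sqFlagAt`
  — the NON-SPLIT / split test `¬ IsSquare (ι q)` / `IsSquare (ι q)` for a rational `q = N/D` from the
  flag (r1's kind (iv′) hypothesis `hγ : ¬ IsSquare (ι (-c₄/c₆))`, p04's row T-NSK);
* `forall_pow_three_eq_one_of_not_isSquare` — in any field, if `-3` is not a square then `1` is
  the only cube root of unity (`ζ² + ζ + 1 = 0 ⟹ (2ζ + 1)² = -3`);
* **`forall_pow_three_eq_one_adicCompletion_of_sqFlagAt`** — the second conjunct from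
  `sqFlagAt p (-3) w₃ = false` with `p^{w₃} ∥ -3` (`w₃ = 1` at `p = 3`, else `0`; e.g. false at
  `p = 2` (`-3 ≡ 5 mod 8`) and at every `p ≡ 2 (mod 3)`, true at `p ≡ 1 (mod 3)`).

Demo instance: the pair 2718d1 ~ 2718f1 at the place of `2` (both non-split multiplicative,
`γ(E)/γ(E′) = N/D` a `2`-adic square, `μ₃(ℚ₂) = 1`) — p18's ROW NOTE of 2026-08-21 in the kernel.
NOT claimed: the reduction-type predicates `HasMultiplicativeReductionAt w` of clause (iii) (Tate /
Kodaira deciders elsewhere in the tree), the named fact `hU2`, any congruence or record.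
References: [SilvermanATAEC1994] V.5.3; [Serre1973] Ch. II §3.3; [CremonaMazur2000] Table 1.
-/

set_option autoImplicit false

noncomputable section

open scoped Classical NumberField
open IsDedekindDomain NumberField Rat.HeightOneSpectrum
open Summit.BirchSwinnertonDyer.Rank1Residual.GaloisImage.PadicSquareClass

namespace Summit.BirchSwinnertonDyer.Rank1Residual.GaloisImage.LocalTorsion3At

/-! ### Square classes are transported by ring isomorphisms -/

/-- `IsSquare` is invariant under a ring isomorphism. [folklore] -/
theorem isSquare_iff_of_ringEquiv {K L : Type*} [CommRing K] [CommRing L] (e : K ≃+* L) (x : K) :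
    IsSquare (e x) ↔ IsSquare x := by
  constructor
  · rintro ⟨r, hr⟩
    refine ⟨e.symm r, ?_⟩
    apply e.injective
    rw [map_mul, RingEquiv.apply_symm_apply, ← hr]
  · rintro ⟨r, hr⟩
    exact ⟨e r, by rw [hr, map_mul]⟩

section Place

variable {p : ℕ} [hp : Fact p.Prime]

/-- **Square classes of rationals: `ℚ_v` versus `ℚ_[p]`.** At the place `v` of `p`,
`ι q = algebraMap ℚ (v.adicCompletion ℚ) q` is a square iff `(q : ℚ_[p])` is (transport along
Mathlib's `ℚ`-algebra isomorphism `adicCompletion.padicEquiv v`). [folklore] -/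
theorem isSquare_algebraMap_adicCompletion_iff_padic (v : HeightOneSpectrum (𝓞 ℚ))
    (hv : (primesEquiv v : ℕ) = p) (q : ℚ) :
    IsSquare (algebraMap ℚ (v.adicCompletion ℚ) q) ↔ IsSquare ((q : ℚ) : ℚ_[p]) := by
  subst hv
  have e := (adicCompletion.padicEquiv v).toAlgEquiv
  rw [← isSquare_iff_of_ringEquiv e.toRingEquiv]
  simp

/-- For integers `N` and `D ≠ 0`: `N/D` is a square in `ℚ_p` iff `N·D` is
(`N/D = (N·D)/D²`). [folklore] -/
theorem isSquare_ratCast_padic_iff_intCast (N D : ℤ) (hD : D ≠ 0) :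
    IsSquare ((((N : ℚ) / (D : ℚ) : ℚ)) : ℚ_[p]) ↔ IsSquare (((N * D : ℤ)) : ℚ_[p]) := by
  have hDp : ((D : ℤ) : ℚ_[p]) ≠ 0 := by exact_mod_cast hD
  have hcast : ((((N : ℚ) / (D : ℚ) : ℚ)) : ℚ_[p]) = (N : ℚ_[p]) / (D : ℚ_[p]) := by push_cast; rfl
  rw [hcast, Int.cast_mul]
  constructor
  · rintro ⟨r, hr⟩
    refine ⟨r * (D : ℚ_[p]), ?_⟩
    have : ((N : ℤ) : ℚ_[p]) = r * r * (D : ℚ_[p]) := by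
      rw [← hr, div_mul_cancel₀ _ hDp]
    rw [this]; ring
  · rintro ⟨r, hr⟩
    refine ⟨r / (D : ℚ_[p]), ?_⟩
    field_simp
    linear_combination hr

/-! ### The twist-class conjunct -/

/-- **Same twist type, decided.** If `A/B = N/D` (`A = -c₄/c₆` of `W`, `B = -c₄′/c₆′` of `E′`, both
non-zero; `N`, `D ≠ 0` integers), `p^w ∥ N·D` and `sqFlagAt p (N·D) w = true`, then
`∃ r : ℚ_v, ι A = r² · ι B` at the place `v` of `p`. [cite: SilvermanATAEC1994, V.5.3] -/
theorem exists_eq_sq_mul_of_sqFlagAt (v : HeightOneSpectrum (𝓞 ℚ)) (hv : (primesEquiv v : ℕ) = p)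
    {A B : ℚ} (hB : B ≠ 0) {N D : ℤ} (hD : D ≠ 0) (hAB : A / B = (N : ℚ) / (D : ℚ))
    {w : ℕ} (hw : (p : ℤ) ^ w ∣ N * D) (hw' : ¬ (p : ℤ) ^ (w + 1) ∣ N * D)
    (hflag : sqFlagAt p (N * D) w = true) :
    ∃ r : v.adicCompletion ℚ,
      algebraMap ℚ (v.adicCompletion ℚ) A = r ^ 2 * algebraMap ℚ (v.adicCompletion ℚ) B := by
  have hsq : IsSquare (algebraMap ℚ (v.adicCompletion ℚ) (A / B)) := by
    rw [isSquare_algebraMap_adicCompletion_iff_padic v hv, hAB, isSquare_ratCast_padic_iff_intCast N D hD]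
    exact (isSquare_intCast_padic_iff_sqFlagAt (N * D) w hw hw').mpr hflag
  obtain ⟨r, hr⟩ := hsq
  refine ⟨r, ?_⟩
  have hBK : algebraMap ℚ (v.adicCompletion ℚ) B ≠ 0 := by
    rw [Ne, map_eq_zero_iff _ (algebraMap ℚ (v.adicCompletion ℚ)).injective]; exact hB
  have : algebraMap ℚ (v.adicCompletion ℚ) A =
      algebraMap ℚ (v.adicCompletion ℚ) (A / B) * algebraMap ℚ (v.adicCompletion ℚ) B := by
    rw [← map_mul, div_mul_cancel₀ _ hB]
  rw [this, hr]; ring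

/-- **Different twist type / NON-SPLIT test, decided**: for a rational `q = N/D` (`D ≠ 0`) with
`p^w ∥ N·D` and `sqFlagAt p (N·D) w = false`, `ι q` is NOT a square in `ℚ_v` (`v` the place of `p`).
With `q = -c₄/c₆` this is the hypothesis `hγ : ¬ IsSquare (ι (-c₄/c₆))` of a non-split multiplicative
place (r1's kind (iv′), p04's row T-NSK). [cite: SilvermanATAEC1994, V.5.3] -/
theorem not_isSquare_algebraMap_adicCompletion_of_sqFlagAt (v : HeightOneSpectrum (𝓞 ℚ))
    (hv : (primesEquiv v : ℕ) = p) {q : ℚ} {N D : ℤ} (hD : D ≠ 0) (hq : q = (N : ℚ) / (D : ℚ))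
    {w : ℕ} (hw : (p : ℤ) ^ w ∣ N * D) (hw' : ¬ (p : ℤ) ^ (w + 1) ∣ N * D)
    (hflag : sqFlagAt p (N * D) w = false) :
    ¬ IsSquare (algebraMap ℚ (v.adicCompletion ℚ) q) := by
  rw [isSquare_algebraMap_adicCompletion_iff_padic v hv, hq, isSquare_ratCast_padic_iff_intCast N D hD,
    isSquare_intCast_padic_iff_sqFlagAt (N * D) w hw hw', hflag]
  exact Bool.false_ne_true

/-- The positive twin: `sqFlagAt p (N·D) w = true` gives `IsSquare (ι q)` (split test / same class).
[cite: SilvermanATAEC1994, V.5.3] -/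
theorem isSquare_algebraMap_adicCompletion_of_sqFlagAt (v : HeightOneSpectrum (𝓞 ℚ))
    (hv : (primesEquiv v : ℕ) = p) {q : ℚ} {N D : ℤ} (hD : D ≠ 0) (hq : q = (N : ℚ) / (D : ℚ))
    {w : ℕ} (hw : (p : ℤ) ^ w ∣ N * D) (hw' : ¬ (p : ℤ) ^ (w + 1) ∣ N * D)
    (hflag : sqFlagAt p (N * D) w = true) :
    IsSquare (algebraMap ℚ (v.adicCompletion ℚ) q) := by
  rw [isSquare_algebraMap_adicCompletion_iff_padic v hv, hq, isSquare_ratCast_padic_iff_intCast N D hD,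
    isSquare_intCast_padic_iff_sqFlagAt (N * D) w hw hw']
  exact hflag

/-! ### The `μ₃` conjunct -/

/-- In a field in which `-3` is not a square, `1` is the only cube root of unity: `ζ³ = 1`,
`ζ ≠ 1` forces `ζ² + ζ + 1 = 0`, i.e. `(2ζ + 1)² = -3` (any characteristic). [folklore] -/
theorem forall_pow_three_eq_one_of_not_isSquare {K : Type*} [Field K]
    (h : ¬ IsSquare (-3 : K)) : ∀ ζ : K, ζ ^ 3 = 1 → ζ = 1 := by
  intro ζ hζ
  by_contra hne
  apply h
  have hfac : (ζ - 1) * (ζ ^ 2 + ζ + 1) = 0 := by linear_combination hζ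
  have hq : ζ ^ 2 + ζ + 1 = 0 := by
    rcases mul_eq_zero.mp hfac with h1 | h2
    · exact absurd (sub_eq_zero.mp h1) hne
    · exact h2
  exact ⟨2 * ζ + 1, by linear_combination (-4 : K) * hq⟩

/-- **`μ₃(ℚ_v) = 1`, decided**: at the place `v` of `p`, if `sqFlagAt p (-3) w₃ = false` with
`p^{w₃} ∥ -3`, then every cube root of unity in `ℚ_v` is `1`. [cite: Serre1973, Ch. II §3.3] -/
theorem forall_pow_three_eq_one_adicCompletion_of_sqFlagAt (v : HeightOneSpectrum (𝓞 ℚ))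
    (hv : (primesEquiv v : ℕ) = p) {w₃ : ℕ} (hw : (p : ℤ) ^ w₃ ∣ (-3 : ℤ))
    (hw' : ¬ (p : ℤ) ^ (w₃ + 1) ∣ (-3 : ℤ)) (hflag : sqFlagAt p (-3) w₃ = false) :
    ∀ ζ : v.adicCompletion ℚ, ζ ^ 3 = 1 → ζ = 1 := by
  apply forall_pow_three_eq_one_of_not_isSquare
  intro hsq
  have h1 : IsSquare (algebraMap ℚ (v.adicCompletion ℚ) (((-3 : ℤ) : ℚ))) := by
    simpa using hsq
  rw [isSquare_algebraMap_adicCompletion_iff_padic v hv] at h1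
  have h2 : IsSquare (((-3 : ℤ)) : ℚ_[p]) := by simpa using h1
  rw [isSquare_intCast_padic_iff_sqFlagAt (-3) w₃ hw hw'] at h2
  rw [h2] at hflag
  exact Bool.noConfusion hflag

end Place

/-! ### Demo instance: 2718d1 ~ 2718f1 at the place of `2` (p18's ROW NOTE in the kernel) -/

/-- **2718d1 ~ 2718f1 at `w = 2`** (Cremona models `[1,-1,0,-364196925,-2675085975131]` and
`[1,-1,0,-99,409]`, both non-split multiplicative at `2`): the two numerals of free kind (iii) hold
in the kernel — `ι(-c₄/c₆) = r²·ι(-c₄′/c₆′)` for some `r ∈ ℚ_v` and `μ₃(ℚ_v) = 1`, `v` the place of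
`2`. [cite: Cremona2006, Table 1 (Cremona labels 2718d1, 2718f1)] [cite: CremonaMazur2000, Table 1] -/
theorem kind_iii_numerals_2718d1_2718f1_at2 (W E' : WeierstrassCurve ℚ)
    (hW : W = ⟨1, -1, 0, -364196925, -2675085975131⟩) (hE' : E' = ⟨1, -1, 0, -99, 409⟩)
    {v : HeightOneSpectrum (𝓞 ℚ)} (hv : (primesEquiv v : ℕ) = 2) :
    (∃ r : v.adicCompletion ℚ, algebraMap ℚ (v.adicCompletion ℚ) (-(W.c₄ / W.c₆)) =
        r ^ 2 * algebraMap ℚ (v.adicCompletion ℚ) (-(E'.c₄ / E'.c₆))) ∧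
      (∀ ζ : v.adicCompletion ℚ, ζ ^ 3 = 1 → ζ = 1) := by
  haveI : Fact (Nat.Prime 2) := ⟨Nat.prime_two⟩
  subst hW; subst hE'
  refine ⟨?_, forall_pow_three_eq_one_adicCompletion_of_sqFlagAt v hv (w₃ := 0) (by norm_num)
    (by norm_num) (by decide +kernel)⟩
  -- `A / B = N / D` with explicit integers, read off the two models by `norm_num`
  refine exists_eq_sq_mul_of_sqFlagAt v hv (N := -23881606374295) (D := 45285396668404697)
    ?_ (by norm_num) ?_ (w := 0) (by norm_num) (by norm_num) (by decide +kernel)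
  · norm_num [WeierstrassCurve.c₄, WeierstrassCurve.c₆, WeierstrassCurve.b₂, WeierstrassCurve.b₄,
      WeierstrassCurve.b₆]
  · norm_num [WeierstrassCurve.c₄, WeierstrassCurve.c₆, WeierstrassCurve.b₂, WeierstrassCurve.b₄,
      WeierstrassCurve.b₆]

end Summit.BirchSwinnertonDyer.Rank1Residual.GaloisImage.LocalTorsion3At

end
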